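import Summits.MatrixMultiplication.OmegaCensus.AtomBadAll

/-!
# ω-census, family (b3): conjecture C9 (b) reduced to the MINIMAL simple groups

HONEST FRAMING (pub-omega census; verbatim): lottery ticket; floor = certified bounds/negative ranges.
Census BOOKKEEPING (conjecture C9 of the cell, STRUCTURE.md §2, `BoxRatioSectionLaw`; pub-omega kernel-l4 gen 18).  Nothing here
is progress on `ω`.

With the atom hypothesis proved (`atomBad_of_five_le`, `AtomBadAll.lean`) the only input `BoxRatioSectionLaw` still needs is (S)
«every finite non-abelian simple group is box-useless» (`boxRatioSectionLaw_of_simple`).  This file sharpens (S) to the MINIMAL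
simple groups:
* `not_boxUseful_of_not_isSolvable_of_minimal` — if every finite non-abelian simple group ALL OF WHOSE PROPER SUBGROUPS ARE
  SOLVABLE is box-useless, then every finite non-solvable group is box-useless (a non-solvable group of least order inside a
  counterexample has all proper subgroups solvable; if it is not simple, a proper normal subgroup `N ≠ 1` is solvable and the
  smaller quotient is non-solvable; box-usefulness descends to subgroups and quotients, C9 (a));
* **`boxRatioSectionLaw_of_minimal_simple`** — `BoxRatioSectionLaw` ⟸ (S′) every finite non-abelian simple group whose proper
  subgroups are all solvable is box-useless.  (By Thompson's classification of minimal simple groups — not in the tree — (S′)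
  is a statement about `PSL₂(2^p), PSL₂(3^p), PSL₂(p), Sz(2^p), PSL₃(3)`, each of which contains `A₄`, dihedral or Frobenius
  configurations that the tree already knows to be box-useless; that last step is NOT claimed here.)
-/

namespace Summit.MatrixMultiplication.OmegaCensus

universe u

/-- **Non-solvable reduces to minimal simple.** If every finite non-abelian simple group all of whose proper subgroups are
solvable is box-useless, then every finite non-solvable group is box-useless. [folklore] -/
theorem not_boxUseful_of_not_isSolvable_of_minimal
    (hS : ∀ (S : Type u) [Group S] [Fintype S] [DecidableEq S], IsSimpleGroup S → (∃ a b : S, a * b ≠ b * a) →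
      (∀ K : Subgroup S, K ≠ ⊤ → IsSolvable K) → ¬ BoxUseful S) :
    ∀ (n : ℕ) (G : Type u) [Group G] [Fintype G] [DecidableEq G], Fintype.card G = n → ¬ IsSolvable G → ¬ BoxUseful G := by
  intro n
  induction n using Nat.strong_induction_on with
  | _ n IH =>
  intro G _ _ _ hn hG hGu
  classical
  -- `G` is non-trivial and non-abelian
  have hcomm : ∃ a b : G, a * b ≠ b * a := by
    by_contra! h
    exact hG (isSolvable_of_comm h)
  haveI : Nontrivial G := by
    obtain ⟨a, b, hab⟩ := hcomm
    by_contra htriv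
    haveI : Subsingleton G := not_nontrivial_iff_subsingleton.1 htriv
    exact hab (Subsingleton.elim _ _)
  -- a proper non-solvable subgroup is a smaller counterexample
  by_cases hmin : ∀ K : Subgroup G, K ≠ ⊤ → IsSolvable K
  swap
  · push Not at hmin
    obtain ⟨K, hKtop, hKs⟩ := hmin
    have hlt : Fintype.card K < n := by
      rw [← hn, ← Nat.card_eq_fintype_card, ← Nat.card_eq_fintype_card, ← K.card_mul_index]
      exact lt_mul_of_one_lt_right Nat.card_pos (Subgroup.one_lt_index_of_ne_top hKtop)
    exact IH _ hlt K rfl hKs (hGu.subgroup K)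
  by_cases hsimple : ∀ N : Subgroup G, N.Normal → N = ⊥ ∨ N = ⊤
  · exact hS G ⟨hsimple⟩ hcomm hmin hGu
  · push Not at hsimple
    obtain ⟨N, hNn, hNbot, hNtop⟩ := hsimple
    haveI := hNn
    -- `N` is proper hence solvable, so `G / N` is non-solvable and smaller
    haveI hNs : IsSolvable N := hmin N hNtop
    have hQ : ¬ IsSolvable (G ⧸ N) := by
      intro hQs
      exact hG (solvable_of_ker_le_range N.subtype (QuotientGroup.mk' N)
        (by rw [QuotientGroup.ker_mk', Subgroup.range_subtype]))
    have hlt : Fintype.card (G ⧸ N) < n := by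
      rw [← hn, ← Nat.card_eq_fintype_card, ← Nat.card_eq_fintype_card,
        Subgroup.card_eq_card_quotient_mul_card_subgroup N]
      exact lt_mul_of_one_lt_right Nat.card_pos (N.one_lt_card_iff_ne_bot.2 hNbot)
    exact IH _ hlt (G ⧸ N) rfl hQ (hGu.quotient N)

/-- **`BoxRatioSectionLaw` ⟸ (S′): every MINIMAL non-abelian simple group (all proper subgroups solvable) is box-useless.**
The atom hypothesis is supplied by `atomBad_of_five_le`. [folklore] -/
theorem boxRatioSectionLaw_of_minimal_simple
    (hS : ∀ (S : Type) [Group S] [Fintype S] [DecidableEq S], IsSimpleGroup S → (∃ a b : S, a * b ≠ b * a) →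
      (∀ K : Subgroup S, K ≠ ⊤ → IsSolvable K) → ¬ BoxUseful S) :
    BoxRatioSectionLaw :=
  boxRatioSectionLaw_of_atomBad_five_of_nonsolvable (fun _ _ hp hq hpq h5 => atomBad_of_five_le hp hq hpq h5)
    (fun H _ _ _ hH => not_boxUseful_of_not_isSolvable_of_minimal hS (Fintype.card H) H rfl hH)

end Summit.MatrixMultiplication.OmegaCensus
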